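import Mathlib

/-!
# `MatrixDescartes` census — rank-one `(2,4)₁`, lone letter: THE CUBIC MOMENT INEQUALITY (abstract form, four atoms)

HONEST FRAMING.  Object-search cell `pub-symmetroid`, seat `val-sym-mdr-p1` (generation 23); helper file `--supports` the crux item
stmt-ValiantsHypothesis-18050 (`Theses.LacunarySymmetroid.MatrixDescartes`, OPEN, on HOLD) with NO closure claim.  PURE ALGEBRA over twelve reals:
the abstract form of the inequality «`𝒞_W > 0` at fold points» to which `…FourLoneLetter.lone_letter_four_right_of_foldCubic_pos` reduces the
`K = 4` fastest-lone-letter law (memo MOMENT-FOLD.md §5).  The companion `…FourFoldCubic` translates the four-letter fold data into this form.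
Nothing here bears on `MatrixDescartes` in its window, on `DoorA26`/`DoorA34`, registers / credences, or `VP ≠ VNP`.

THE STATEMENT (`cubicMoment_pos`).  Four atoms `0, i, k, j` with masses `d > 0` and two real «random variables» `U`, `R` such that
`E U = E R = E[UR] = 0` (`E` = the `d`-weighted sum); `U₀ > 0 > Uᵢ, Uₖ ≥ Uⱼ` (the pivot is the only positive atom, the lone letter the most
negative); with `gₘ := Uₘ + Rₘ`: `0 ≤ gᵢ, gₖ ≤ g₀` (positivity and ORDER); and the GAP `E U² − E R² < (∑d)·gₘ²` for `m = i, k`.  Then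
`E[U³] > 3·E[U R²]`.  (In the application `U = κβ`, `R = g − κβ` for the Gibbs measure `dₘ ∝ Wₘ(T−tₘ)²`, `gₘ = S₂·(T+tₘ)/(T−tₘ)`; the GAP is
the fold relation plus `tₘ > 0`; ORDER is `tᵢ, tₖ ≤ t₀`; see the companion file.)

THE PROOF (memo §5, three lines).  (Q) `mixedCubic_nonpos`: `E[U R²] ≤ 0` by ONE Cauchy–Schwarz — `(d₀U₀R₀)² = (∑_{m≠0} dₘ|Uₘ|Rₘ)² ≤
(∑dₘ|Uₘ|)(∑dₘ|Uₘ|Rₘ²)` and `∑_{m≠0}dₘ|Uₘ| = d₀U₀` (Lagrange's identity, `linear_combination`).  (R′) `triangle_nonneg`: on the region `gᵢ ≤ gₖ` the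
quantity `F = ∑_{m≠j} dₘ(Uₘ−Uⱼ)gₘ(2Uₘ−gₘ) − (∑d)|Uⱼ|gᵢ²` is a CONCAVE quadratic in `(gᵢ, gₖ)` on a triangle whose vertices give `F ≥ 0, ≥ 0, = 0`
(the all-tight corner); the barycentric/Jensen certificate is the explicit polynomial identity `triangle_certificate` (all terms products of
nonnegative factors).  Assembly: `E U³ − 3E[UR²] = 3(F + |Uⱼ|·GAP-slack) − 2E U³`, positive when `E U³ ≤ 0`; and `≥ E U³ > 0` otherwise by (Q).
[folklore] Cauchy–Schwarz / Lagrange identity, Jensen for a concave quadratic on a triangle, written as polynomial identities.  No definitions.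
-/

-- `Summit.ValiantsHypothesis.ValiantsHypothesis.…` repeats a component by the D-0017 layout
-- (single-conjunct summit), which the `dupNamespace` linter flags; the name is mandated.
set_option linter.dupNamespace false

namespace Summit.ValiantsHypothesis.ValiantsHypothesis.Theorems.LacunarySymmetroidMatrixDescartes.Pivot.CriticalWindows.Four

/-! ## 1. (Q) The mixed cubic moment is nonpositive -/

/-- **`E[U R²] ≤ 0`.**  If `E U = 0`, `E[UR] = 0`, the pivot atom is the only one with `U > 0`, then `∑ dₘUₘRₘ² ≤ 0`
(Lagrange's identity: `d₀U₀·∑dₘUₘRₘ² = −∑_{m<n, m,n≠0} dₘ|Uₘ|dₙ|Uₙ|(Rₘ−Rₙ)²`). [folklore] -/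
theorem mixedCubic_nonpos {d₀ di dk dj U₀ Ui Uk Uj R₀ Ri Rk Rj : ℝ} (hd₀ : 0 < d₀) (hdi : 0 ≤ di) (hdk : 0 ≤ dk) (hdj : 0 ≤ dj)
    (hU₀ : 0 < U₀) (hUi : Ui ≤ 0) (hUk : Uk ≤ 0) (hUj : Uj ≤ 0)
    (hEU : d₀ * U₀ + di * Ui + dk * Uk + dj * Uj = 0)
    (hEUR : d₀ * U₀ * R₀ + di * Ui * Ri + dk * Uk * Rk + dj * Uj * Rj = 0) :
    d₀ * U₀ * R₀ ^ 2 + di * Ui * Ri ^ 2 + dk * Uk * Rk ^ 2 + dj * Uj * Rj ^ 2 ≤ 0 := by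
  have key : d₀ * U₀ * (d₀ * U₀ * R₀ ^ 2 + di * Ui * Ri ^ 2 + dk * Uk * Rk ^ 2 + dj * Uj * Rj ^ 2) + ((-(di * Ui)) * (-(dk * Uk)) * (Ri - Rk) ^ 2 + (-(di * Ui)) * (-(dj * Uj)) * (Ri - Rj) ^ 2 + (-(dk * Uk)) * (-(dj * Uj)) * (Rk - Rj) ^ 2) = 0 := by
    linear_combination (2 * ((-(di * Ui)) * Ri + (-(dk * Uk)) * Rk + (-(dj * Uj)) * Rj) + (d₀ * U₀ * R₀ + di * Ui * Ri + dk * Uk * Rk + dj * Uj * Rj)) * hEUR - ((-(di * Ui)) * Ri ^ 2 + (-(dk * Uk)) * Rk ^ 2 + (-(dj * Uj)) * Rj ^ 2) * hEU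
  have hai : 0 ≤ -(di * Ui) := by nlinarith
  have hak : 0 ≤ -(dk * Uk) := by nlinarith
  have haj : 0 ≤ -(dj * Uj) := by nlinarith
  have hlag : 0 ≤ ((-(di * Ui)) * (-(dk * Uk)) * (Ri - Rk) ^ 2 + (-(di * Ui)) * (-(dj * Uj)) * (Ri - Rj) ^ 2 + (-(dk * Uk)) * (-(dj * Uj)) * (Rk - Rj) ^ 2) := by positivity
  by_contra hcon
  push Not at hcon
  have := mul_pos (mul_pos hd₀ hU₀) hcon
  linarith

/-! ## 2. (R′) The triangle certificate -/

/-- **BARYCENTRIC / JENSEN CERTIFICATE (free symbols).**  With `D₂ = c₀+cₖ`, `D₃ = c₀+cᵢ+cₖ`, under the two linear relations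
`c₀g₀ + cᵢgᵢ + cₖgₖ = Q₂` and `c₀U₀ + cᵢUᵢ + cₖUₖ = Q₂`:
`Q₂c₀D₂D₃·F = D₂D₃·c₀(g₀−gₖ)·Q₂(2U₀c₀−Q₂) + c₀D₃·(gₖ−gᵢ)D₂·Q₂(2U₀c₀+2Uₖcₖ−Q₂) + Q₂D₃cₖ·c₀(g₀−gₖ)·(gₖ−gᵢ)D₂ + Q₂D₂D₃²gᵢ·c₀(g₀−gₖ)
 + Q₂c₀D₂gᵢ(gₖ−gᵢ)(cᵢ² + cᵢD₂ + D₂D₃)` for `F = c₀g₀(2U₀−g₀) + cᵢgᵢ(2Uᵢ−gᵢ) + cₖgₖ(2Uₖ−gₖ) − D₃gᵢ²` — the concave quadratic `F` on the triangle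
with vertices `(gᵢ,gₖ) = (0,0), (0, Q₂/D₂), (Q₂/D₃, Q₂/D₃)` written as barycentric combination of its vertex values plus the Jensen gap. [folklore] -/
theorem triangle_certificate (c0 ci ck Q2 U0 Ui Uk gi gk g0 : ℝ) (hL : c0 * g0 + ci * gi + ck * gk = Q2)
    (hM : c0 * U0 + ci * Ui + ck * Uk = Q2) :
    Q2 * c0 * (c0 + ck) * (c0 + ci + ck) * (c0 * g0 * (2 * U0 - g0) + ci * gi * (2 * Ui - gi) + ck * gk * (2 * Uk - gk) - (c0 + ci + ck) * gi ^ 2)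
      = ((c0 + ck) * (c0 + ci + ck) * (c0 * (g0 - gk)) * (Q2 * (2 * U0 * c0 - Q2)) + c0 * (c0 + ci + ck) * ((gk - gi) * (c0 + ck)) * (Q2 * (2 * U0 * c0 + 2 * Uk * ck - Q2)) + Q2 * (c0 + ci + ck) * ck * (c0 * (g0 - gk)) * ((gk - gi) * (c0 + ck)) + Q2 * (c0 + ck) * (c0 + ci + ck) ^ 2 * gi * (c0 * (g0 - gk)) + Q2 * c0 * (c0 + ck) * gi * (gk - gi) * (ci ^ 2 + ci * (c0 + ck) + (c0 + ck) * (c0 + ci + ck))) := by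
  linear_combination (-(Q2 * c0 * (c0 + ck) * (c0 + ci + ck) * (g0 + gi))) * hL + (2 * Q2 * c0 * (c0 + ck) * (c0 + ci + ck) * gi) * hM

/-- **`F ≥ 0` ON THE TRIANGLE** (region `gᵢ ≤ gₖ ≤ g₀`, `gᵢ ≥ 0`), given `c₀ > 0`, `cᵢ, cₖ ≥ 0`, `Q₂ > 0`, the two vertex inequalities
`Q₂ ≤ 2U₀c₀`, `Q₂ ≤ 2U₀c₀ + 2Uₖcₖ`, and the two linear relations. [folklore] -/
theorem triangle_nonneg {c0 ci ck Q2 U0 Ui Uk gi gk g0 : ℝ} (hc0 : 0 < c0) (hci : 0 ≤ ci) (hck : 0 ≤ ck) (hQ2 : 0 < Q2)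
    (hgi : 0 ≤ gi) (hik : gi ≤ gk) (hk0 : gk ≤ g0) (hA : Q2 ≤ 2 * U0 * c0) (hB : Q2 ≤ 2 * U0 * c0 + 2 * Uk * ck)
    (hL : c0 * g0 + ci * gi + ck * gk = Q2) (hM : c0 * U0 + ci * Ui + ck * Uk = Q2) :
    0 ≤ (c0 * g0 * (2 * U0 - g0) + ci * gi * (2 * Ui - gi) + ck * gk * (2 * Uk - gk) - (c0 + ci + ck) * gi ^ 2) := by
  have id := triangle_certificate c0 ci ck Q2 U0 Ui Uk gi gk g0 hL hM
  have h1 : 0 ≤ c0 * (g0 - gk) := mul_nonneg hc0.le (by linarith)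
  have h2 : 0 ≤ (gk - gi) * (c0 + ck) := mul_nonneg (by linarith) (by linarith)
  have h3 : 0 ≤ Q2 * (2 * U0 * c0 - Q2) := mul_nonneg hQ2.le (by linarith)
  have h4 : 0 ≤ Q2 * (2 * U0 * c0 + 2 * Uk * ck - Q2) := mul_nonneg hQ2.le (by linarith)
  have hD2 : 0 < c0 + ck := by linarith
  have hD3 : 0 < c0 + ci + ck := by linarith
  have hrhs : 0 ≤ ((c0 + ck) * (c0 + ci + ck) * (c0 * (g0 - gk)) * (Q2 * (2 * U0 * c0 - Q2)) + c0 * (c0 + ci + ck) * ((gk - gi) * (c0 + ck)) * (Q2 * (2 * U0 * c0 + 2 * Uk * ck - Q2)) + Q2 * (c0 + ci + ck) * ck * (c0 * (g0 - gk)) * ((gk - gi) * (c0 + ck)) + Q2 * (c0 + ck) * (c0 + ci + ck) ^ 2 * gi * (c0 * (g0 - gk)) + Q2 * c0 * (c0 + ck) * gi * (gk - gi) * (ci ^ 2 + ci * (c0 + ck) + (c0 + ck) * (c0 + ci + ck))) := by positivity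
  have hpos : 0 < Q2 * c0 * (c0 + ck) * (c0 + ci + ck) := by positivity
  rw [← id] at hrhs
  exact nonneg_of_mul_nonneg_right hrhs hpos |> fun h => h


/-! ## 3. The cubic moment inequality -/

/-- **THE CUBIC MOMENT INEQUALITY (four atoms).**  Masses `d > 0`; `E U = E R = E[UR] = 0`; `U₀ > 0 > Uᵢ, Uₖ`, `Uⱼ ≤ Uᵢ, Uₖ`; `gₘ = Uₘ + Rₘ` with
`0 ≤ gᵢ, gₖ ≤ g₀`; GAP `E U² − E R² < (∑d)·gₘ²` (`m = i, k`).  Then `E[U³] > 3E[U R²]`. [folklore] -/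
theorem cubicMoment_pos {d₀ di dk dj U₀ Ui Uk Uj R₀ Ri Rk Rj : ℝ} (hd₀ : 0 < d₀) (hdi : 0 < di) (hdk : 0 < dk) (hdj : 0 < dj)
    (hU₀ : 0 < U₀) (hUi : Ui < 0) (hUk : Uk < 0) (hji : Uj ≤ Ui) (hjk : Uj ≤ Uk)
    (hEU : d₀ * U₀ + di * Ui + dk * Uk + dj * Uj = 0)
    (hER : d₀ * R₀ + di * Ri + dk * Rk + dj * Rj = 0)
    (hEUR : d₀ * U₀ * R₀ + di * Ui * Ri + dk * Uk * Rk + dj * Uj * Rj = 0)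
    (hgi : 0 ≤ Ui + Ri) (hgk : 0 ≤ Uk + Rk) (hoi : Ui + Ri ≤ U₀ + R₀) (hok : Uk + Rk ≤ U₀ + R₀)
    (hgapi : (d₀ * U₀ ^ 2 + di * Ui ^ 2 + dk * Uk ^ 2 + dj * Uj ^ 2) - (d₀ * R₀ ^ 2 + di * Ri ^ 2 + dk * Rk ^ 2 + dj * Rj ^ 2) < (d₀ + di + dk + dj) * (Ui + Ri) ^ 2)
    (hgapk : (d₀ * U₀ ^ 2 + di * Ui ^ 2 + dk * Uk ^ 2 + dj * Uj ^ 2) - (d₀ * R₀ ^ 2 + di * Ri ^ 2 + dk * Rk ^ 2 + dj * Rj ^ 2) < (d₀ + di + dk + dj) * (Uk + Rk) ^ 2) :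
    0 < (d₀ * U₀ ^ 3 + di * Ui ^ 3 + dk * Uk ^ 3 + dj * Uj ^ 3) - 3 * (d₀ * U₀ * R₀ ^ 2 + di * Ui * Ri ^ 2 + dk * Uk * Rk ^ 2 + dj * Uj * Rj ^ 2) := by
  have hUj : Uj < 0 := lt_of_le_of_lt hji hUi
  have hQ := mixedCubic_nonpos hd₀ hdi.le hdk.le hdj.le hU₀ hUi.le hUk.le hUj.le hEU hEUR
  -- the coefficients of the triangle lemma
  have hc0 : 0 < (d₀ * (U₀ - Uj)) := mul_pos hd₀ (by linarith)
  have hci : 0 ≤ (di * (Ui - Uj)) := mul_nonneg hdi.le (by linarith)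
  have hck : 0 ≤ (dk * (Uk - Uj)) := mul_nonneg hdk.le (by linarith)
  have hQ2 : 0 < d₀ * U₀ ^ 2 + di * Ui ^ 2 + dk * Uk ^ 2 + dj * Uj ^ 2 := by
    have : 0 < d₀ * U₀ ^ 2 := mul_pos hd₀ (pow_pos hU₀ 2)
    have : 0 ≤ di * Ui ^ 2 := by positivity
    have : 0 ≤ dk * Uk ^ 2 := by positivity
    have : 0 ≤ dj * Uj ^ 2 := by positivity
    linarith
  have hM : (d₀ * (U₀ - Uj)) * U₀ + (di * (Ui - Uj)) * Ui + (dk * (Uk - Uj)) * Uk = d₀ * U₀ ^ 2 + di * Ui ^ 2 + dk * Uk ^ 2 + dj * Uj ^ 2 := by linear_combination (-Uj) * hEU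
  have hL : (d₀ * (U₀ - Uj)) * (U₀ + R₀) + (di * (Ui - Uj)) * (Ui + Ri) + (dk * (Uk - Uj)) * (Uk + Rk) = d₀ * U₀ ^ 2 + di * Ui ^ 2 + dk * Uk ^ 2 + dj * Uj ^ 2 := by
    linear_combination hEUR - Uj * hER - Uj * hEU
  have hA : d₀ * U₀ ^ 2 + di * Ui ^ 2 + dk * Uk ^ 2 + dj * Uj ^ 2 ≤ 2 * U₀ * (d₀ * (U₀ - Uj)) := by
    have e : U₀ * (d₀ * (U₀ - Uj)) - (d₀ * U₀ ^ 2 + di * Ui ^ 2 + dk * Uk ^ 2 + dj * Uj ^ 2) = -(di * Ui * (Ui - Uj)) - dk * Uk * (Uk - Uj) + (-Uj) * (d₀ * U₀ + di * Ui + dk * Uk + dj * Uj) := by ring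
    rw [hEU, mul_zero, add_zero] at e
    have t1 : 0 ≤ -(di * Ui * (Ui - Uj)) := by
      have := mul_nonneg (mul_nonneg hdi.le (by linarith : (0:ℝ) ≤ -Ui)) (by linarith : (0:ℝ) ≤ Ui - Uj); linarith
    have t2 : 0 ≤ -(dk * Uk * (Uk - Uj)) := by
      have := mul_nonneg (mul_nonneg hdk.le (by linarith : (0:ℝ) ≤ -Uk)) (by linarith : (0:ℝ) ≤ Uk - Uj); linarith
    have hU0c0 : 0 < U₀ * (d₀ * (U₀ - Uj)) := mul_pos hU₀ hc0
    linarith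
  have hBk : d₀ * U₀ ^ 2 + di * Ui ^ 2 + dk * Uk ^ 2 + dj * Uj ^ 2 ≤ 2 * U₀ * (d₀ * (U₀ - Uj)) + 2 * Uk * (dk * (Uk - Uj)) := by
    have e : 2 * U₀ * (d₀ * (U₀ - Uj)) + 2 * Uk * (dk * (Uk - Uj)) - (d₀ * U₀ ^ 2 + di * Ui ^ 2 + dk * Uk ^ 2 + dj * Uj ^ 2) = d₀ * U₀ ^ 2 + di * (-Ui) * (Ui - 2 * Uj) + dk * Uk ^ 2 + dj * Uj ^ 2 - 2 * Uj * (d₀ * U₀ + di * Ui + dk * Uk + dj * Uj) := by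
      ring
    rw [hEU, mul_zero, sub_zero] at e
    have t1 : 0 ≤ di * (-Ui) * (Ui - 2 * Uj) := mul_nonneg (mul_nonneg hdi.le (by linarith)) (by linarith)
    have : 0 ≤ d₀ * U₀ ^ 2 := by positivity
    have : 0 ≤ dk * Uk ^ 2 := by positivity
    have : 0 ≤ dj * Uj ^ 2 := by positivity
    linarith
  have hBi : d₀ * U₀ ^ 2 + di * Ui ^ 2 + dk * Uk ^ 2 + dj * Uj ^ 2 ≤ 2 * U₀ * (d₀ * (U₀ - Uj)) + 2 * Ui * (di * (Ui - Uj)) := by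
    have e : 2 * U₀ * (d₀ * (U₀ - Uj)) + 2 * Ui * (di * (Ui - Uj)) - (d₀ * U₀ ^ 2 + di * Ui ^ 2 + dk * Uk ^ 2 + dj * Uj ^ 2) = d₀ * U₀ ^ 2 + dk * (-Uk) * (Uk - 2 * Uj) + di * Ui ^ 2 + dj * Uj ^ 2 - 2 * Uj * (d₀ * U₀ + di * Ui + dk * Uk + dj * Uj) := by
      ring
    rw [hEU, mul_zero, sub_zero] at e
    have t1 : 0 ≤ dk * (-Uk) * (Uk - 2 * Uj) := mul_nonneg (mul_nonneg hdk.le (by linarith)) (by linarith)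
    have : 0 ≤ d₀ * U₀ ^ 2 := by positivity
    have : 0 ≤ di * Ui ^ 2 := by positivity
    have : 0 ≤ dj * Uj ^ 2 := by positivity
    linarith
  -- `F ≥ 0` in both regions: `Φ ≥ (∑d)|Uⱼ| g*²`
  have hD3 : (d₀ * (U₀ - Uj)) + (di * (Ui - Uj)) + (dk * (Uk - Uj)) = (d₀ + di + dk + dj) * (-Uj) := by linear_combination hEU
  have hPhi : (d₀ * U₀ ^ 3 + di * Ui ^ 3 + dk * Uk ^ 3 + dj * Uj ^ 3) - (d₀ * U₀ * R₀ ^ 2 + di * Ui * Ri ^ 2 + dk * Uk * Rk ^ 2 + dj * Uj * Rj ^ 2) - Uj * ((d₀ * U₀ ^ 2 + di * Ui ^ 2 + dk * Uk ^ 2 + dj * Uj ^ 2) - (d₀ * R₀ ^ 2 + di * Ri ^ 2 + dk * Rk ^ 2 + dj * Rj ^ 2)) = ((d₀ * (U₀ - Uj)) * (U₀ + R₀) * (2 * U₀ - (U₀ + R₀)) + (di * (Ui - Uj)) * (Ui + Ri) * (2 * Ui - (Ui + Ri)) + (dk * (Uk - Uj)) * (Uk + Rk) * (2 * Uk - (Uk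 + Rk))) := by ring
  -- case split on `E U³`
  by_cases h3 : 0 < d₀ * U₀ ^ 3 + di * Ui ^ 3 + dk * Uk ^ 3 + dj * Uj ^ 3
  · linarith
  · push Not at h3
    rcases le_total (Ui + Ri) (Uk + Rk) with hik | hki
    · -- region i: g* = gᵢ
      have hF := triangle_nonneg (gi := (Ui + Ri)) (gk := (Uk + Rk)) (g0 := (U₀ + R₀)) hc0 hci hck hQ2 hgi hik hok hA hBk hL hM
      rw [hD3] at hF
      have hslack : 0 < (d₀ + di + dk + dj) * (Ui + Ri) ^ 2 - ((d₀ * U₀ ^ 2 + di * Ui ^ 2 + dk * Uk ^ 2 + dj * Uj ^ 2) - (d₀ * R₀ ^ 2 + di * Ri ^ 2 + dk * Rk ^ 2 + dj * Rj ^ 2)) := by linarith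
      have hkey : (d₀ * U₀ ^ 3 + di * Ui ^ 3 + dk * Uk ^ 3 + dj * Uj ^ 3) - 3 * (d₀ * U₀ * R₀ ^ 2 + di * Ui * Ri ^ 2 + dk * Uk * Rk ^ 2 + dj * Uj * Rj ^ 2) = 3 * (((d₀ * (U₀ - Uj)) * (U₀ + R₀) * (2 * U₀ - (U₀ + R₀)) + (di * (Ui - Uj)) * (Ui + Ri) * (2 * Ui - (Ui + Ri)) + (dk * (Uk - Uj)) * (Uk + Rk) * (2 * Uk - (Uk + Rk))) - (d₀ + di + dk + dj) * (-Uj) * (Ui + Ri) ^ 2)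
          + 3 * (-Uj) * ((d₀ + di + dk + dj) * (Ui + Ri) ^ 2 - ((d₀ * U₀ ^ 2 + di * Ui ^ 2 + dk * Uk ^ 2 + dj * Uj ^ 2) - (d₀ * R₀ ^ 2 + di * Ri ^ 2 + dk * Rk ^ 2 + dj * Rj ^ 2))) - 2 * (d₀ * U₀ ^ 3 + di * Ui ^ 3 + dk * Uk ^ 3 + dj * Uj ^ 3) := by
        linear_combination (3:ℝ) * hPhi - 3 * hPhi
      have t1 : 0 ≤ ((d₀ * (U₀ - Uj)) * (U₀ + R₀) * (2 * U₀ - (U₀ + R₀)) + (di * (Ui - Uj)) * (Ui + Ri) * (2 * Ui - (Ui + Ri)) + (dk * (Uk - Uj)) * (Uk + Rk) * (2 * Uk - (Uk + Rk))) - (d₀ + di + dk + dj) * (-Uj) * (Ui + Ri) ^ 2 := by linarith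
      have t2 : 0 < 3 * (-Uj) * ((d₀ + di + dk + dj) * (Ui + Ri) ^ 2 - ((d₀ * U₀ ^ 2 + di * Ui ^ 2 + dk * Uk ^ 2 + dj * Uj ^ 2) - (d₀ * R₀ ^ 2 + di * Ri ^ 2 + dk * Rk ^ 2 + dj * Rj ^ 2))) := by
        have := mul_pos (by linarith : (0:ℝ) < -Uj) hslack; linarith
      linarith
    · -- region k: g* = gₖ (swap the roles of i and k)
      have hL' : (d₀ * (U₀ - Uj)) * (U₀ + R₀) + (dk * (Uk - Uj)) * (Uk + Rk) + (di * (Ui - Uj)) * (Ui + Ri) = d₀ * U₀ ^ 2 + di * Ui ^ 2 + dk * Uk ^ 2 + dj * Uj ^ 2 := by linarith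
      have hM' : (d₀ * (U₀ - Uj)) * U₀ + (dk * (Uk - Uj)) * Uk + (di * (Ui - Uj)) * Ui = d₀ * U₀ ^ 2 + di * Ui ^ 2 + dk * Uk ^ 2 + dj * Uj ^ 2 := by linarith
      have hF := triangle_nonneg (gi := (Uk + Rk)) (gk := (Ui + Ri)) (g0 := (U₀ + R₀)) hc0 hck hci hQ2 hgk hki hoi hA hBi hL' hM'
      have hD3' : (d₀ * (U₀ - Uj)) + (dk * (Uk - Uj)) + (di * (Ui - Uj)) = (d₀ + di + dk + dj) * (-Uj) := by linear_combination hEU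
      rw [hD3'] at hF
      have hslack : 0 < (d₀ + di + dk + dj) * (Uk + Rk) ^ 2 - ((d₀ * U₀ ^ 2 + di * Ui ^ 2 + dk * Uk ^ 2 + dj * Uj ^ 2) - (d₀ * R₀ ^ 2 + di * Ri ^ 2 + dk * Rk ^ 2 + dj * Rj ^ 2)) := by linarith
      have hkey : (d₀ * U₀ ^ 3 + di * Ui ^ 3 + dk * Uk ^ 3 + dj * Uj ^ 3) - 3 * (d₀ * U₀ * R₀ ^ 2 + di * Ui * Ri ^ 2 + dk * Uk * Rk ^ 2 + dj * Uj * Rj ^ 2) = 3 * (((d₀ * (U₀ - Uj)) * (U₀ + R₀) * (2 * U₀ - (U₀ + R₀)) + (di * (Ui - Uj)) * (Ui + Ri) * (2 * Ui - (Ui + Ri)) + (dk * (Uk - Uj)) * (Uk + Rk) * (2 * Uk - (Uk + Rk))) - (d₀ + di + dk + dj) * (-Uj) * (Uk + Rk) ^ 2)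
          + 3 * (-Uj) * ((d₀ + di + dk + dj) * (Uk + Rk) ^ 2 - ((d₀ * U₀ ^ 2 + di * Ui ^ 2 + dk * Uk ^ 2 + dj * Uj ^ 2) - (d₀ * R₀ ^ 2 + di * Ri ^ 2 + dk * Rk ^ 2 + dj * Rj ^ 2))) - 2 * (d₀ * U₀ ^ 3 + di * Ui ^ 3 + dk * Uk ^ 3 + dj * Uj ^ 3) := by
        linear_combination (3:ℝ) * hPhi - 3 * hPhi
      have t1 : 0 ≤ ((d₀ * (U₀ - Uj)) * (U₀ + R₀) * (2 * U₀ - (U₀ + R₀)) + (di * (Ui - Uj)) * (Ui + Ri) * (2 * Ui - (Ui + Ri)) + (dk * (Uk - Uj)) * (Uk + Rk) * (2 * Uk - (Uk + Rk))) - (d₀ + di + dk + dj) * (-Uj) * (Uk + Rk) ^ 2 := by linarith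
      have t2 : 0 < 3 * (-Uj) * ((d₀ + di + dk + dj) * (Uk + Rk) ^ 2 - ((d₀ * U₀ ^ 2 + di * Ui ^ 2 + dk * Uk ^ 2 + dj * Uj ^ 2) - (d₀ * R₀ ^ 2 + di * Ri ^ 2 + dk * Rk ^ 2 + dj * Rj ^ 2))) := by
        have := mul_pos (by linarith : (0:ℝ) < -Uj) hslack; linarith
      linarith

end Summit.ValiantsHypothesis.ValiantsHypothesis.Theorems.LacunarySymmetroidMatrixDescartes.Pivot.CriticalWindows.Four
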